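import Summits.CriticalPhenomena.Ising3D.TaylorTableDecidable
import Mathlib.Tactic.Linarith
import Mathlib.Tactic.Positivity
import Mathlib.Tactic.Ring
import HarnessLib

/-!
# The TABLE layer of a derivative certificate, XVII: the table theorem with the HEAD layers as named hypotheses (route-agnostic capstone)
(cell `pub-ising3x`, seat boot-1 gen 8; gate (g2) — wiring of the FAST head layer into the table theorem)

HONEST FRAMING: lottery ticket; floor = tightest certified 3D Ising CFT bounds; no exact-solution
claim without a proof. Island framing: certified exclusion region at stated derivative order and
assumptions; not a determination of the 3D Ising critical exponents beyond that.

MEASURED (boot-1 g7, HOME/pub-ising3x-boot-1/COST-HEAD-KERNEL.md): the kd-tree ("POLYBOX") head checks inside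
`TaylorTable.check` (`checkEvenCell` / `checkOddCell`: natural interval extension of the closed-form head expressions)
cost hours to days of kernel time per cell of a real Λ = 11 certificate, so a kernel-replayed certificate cannot go
through `T.check`. The FAST layer (`TaylorTableEvenHeadFast` / `…Parts` / `…RowsTable`) proves the SAME per-cell
conclusion by interval rows × Taylor models in tens of seconds per declaration. This file re-cuts the table theorem so
that ANY head route plugs in:
* `TaylorTable.checkS` — the STRUCTURAL part of `T.check` (basic checks, power enclosures + identity kd-certificate,
  per-cell hygiene and canonical head sets, the two covers) — everything of `T.check` except the per-cell kd-tree sign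
  checks and the enclosure-length bookkeeping; cheap (`checkS_of_check`: implied by `T.check`);
* `TaylorTable.EvenHeads` / `TaylorTable.OddHeads` — the two head layers as named Props: for every listed even cell the
  head form is PSD on box × cell (the conclusion of `evenHead_nonneg_of_kdCheck` = of `evenHead_nonneg_of_tmOK` = of
  `evenHead_nonneg_of_parts`); for every listed odd cell the regularised bracket sum is `≥ 0` on box × cell for
  `b_ℓ < Δ` (the conclusion of `oddHead_nonneg_of_kdCheck_reg'`);
* **`TaylorTable.boxExcluded_of_taylorTable_heads`**:
  `T.checkS = true → T.EvenHeads → T.OddHeads → TaylorEvenRegion T.α T.box E₀ → T.OddCone → BoxExcluded T.box` —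
  NO coefficient-enclosure hypothesis at all (enclosures were only ever used inside the kd-tree head checks);
* the kd-tree route as ONE instance: `evenHeads_of_kdCheck` (`T.evenCells.all T.checkEvenCell` + the decidable even
  enclosures), `oddHeads_of_kdCheck` (`T.checkBasic`, `T.checkIdentity`, `T.oddCells.all T.checkOddCell` + the decidable
  odd enclosures), and the hypotheses of the landed `boxExcluded_of_taylorTable_dec` shown to give both head layers
  (`heads_of_check_checkEncl`; the landed theorem then factors through the new capstone) — so nothing is lost and the FAST / Taylor-model
  / δ-expanded head files discharge `EvenHeads` (this seat's next files) and, later, `OddHeads`.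
Proof of the capstone: verbatim the proof of `boxExcluded_of_taylorTable_strict` with the two head bullets replaced by
the hypotheses. Sources: Kos–Poland–Simmons-Duffin 2014 §3.3 eq. (3.16). Elementary given the tree. [folklore]
-/

namespace Summit.CriticalPhenomena.Ising3D

open Finset Set
open Literature.MathematicalPhysics.QuantumFieldTheory.ConformalBootstrap3D
open Literature.Analysis.ValidatedNumerics

namespace TaylorTable

variable (T : TaylorTable)

/-! ### The structural checks -/

/-- Per even cell, STRUCTURE only: head list duplicate-free and in the descendant range, `ℓ ≤ lo`, canonical head set
(no enclosure bookkeeping, no kd-tree checks). [folklore] -/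
def checkEvenCellS (C : EvenCellData) : Bool :=
  decide C.F.Nodup && (C.F.all fun q => decide (q.2 ≤ C.ℓ + q.1)) && decide ((C.ℓ : ℚ) ≤ C.lo) &&
    canonOK C.ℓ C.lo T.E₀ C.F

/-- Per odd cell, STRUCTURE only (as `checkEvenCellS`, threshold `E_T`). [folklore] -/
def checkOddCellS (C : OddCellData) : Bool :=
  decide C.F.Nodup && (C.F.all fun q => decide (q.2 ≤ C.ℓ + q.1)) && decide ((C.ℓ : ℚ) ≤ C.lo) &&
    canonOK C.ℓ C.lo T.E_T C.F

/-- **The structural part of the table check**: basic checks, power enclosures and the identity certificate, per-cell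
structure, the even and odd covers. [folklore] -/
def checkS : Bool :=
  T.checkBasic && T.checkIdentity && T.evenCells.all T.checkEvenCellS && T.checkEvenCover &&
    T.oddCells.all T.checkOddCellS && T.checkOddCover

/-- `checkEvenCell ⇒ checkEvenCellS`. [folklore] -/
theorem checkEvenCellS_of_checkEvenCell {C : EvenCellData} (h : T.checkEvenCell C = true) :
    T.checkEvenCellS C = true := by
  simp only [checkEvenCell, Bool.and_eq_true] at h
  obtain ⟨⟨⟨⟨⟨⟨⟨h1, h2⟩, h3⟩, _⟩, h5⟩, _⟩, _⟩, _⟩ := h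
  simp only [checkEvenCellS, Bool.and_eq_true]
  exact ⟨⟨⟨h1, h2⟩, h3⟩, h5⟩

/-- `checkOddCell ⇒ checkOddCellS`. [folklore] -/
theorem checkOddCellS_of_checkOddCell {C : OddCellData} (h : T.checkOddCell C = true) :
    T.checkOddCellS C = true := by
  simp only [checkOddCell, Bool.and_eq_true] at h
  obtain ⟨⟨⟨⟨⟨h1, h2⟩, h3⟩, _⟩, h5⟩, _⟩ := h
  simp only [checkOddCellS, Bool.and_eq_true]
  exact ⟨⟨⟨h1, h2⟩, h3⟩, h5⟩

/-- **`T.check ⇒ T.checkS`.** [folklore] -/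
theorem checkS_of_check (h : T.check = true) : T.checkS = true := by
  simp only [check, Bool.and_eq_true] at h
  obtain ⟨⟨⟨⟨⟨hB, hI⟩, hEcells⟩, hEcov⟩, hOcells⟩, hOcov⟩ := h
  rw [List.all_eq_true] at hEcells hOcells
  simp only [checkS, Bool.and_eq_true, List.all_eq_true]
  exact ⟨⟨⟨⟨⟨hB, hI⟩, fun C hC => T.checkEvenCellS_of_checkEvenCell (hEcells C hC)⟩, hEcov⟩,
    fun C hC => T.checkOddCellS_of_checkOddCell (hOcells C hC)⟩, hOcov⟩

/-! ### The head layers as named hypotheses -/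

/-- **HEAD LAYER, even sector** (route-agnostic): for every listed even head cell, every `(Δσ, Δε)` of the box and
every `Δ` of the cell, the head form `Σ_{(n,j) ∈ F} (A_{n,j}(Δ,ℓ)/λ_ℓ) · (even 2×2 form of the functional at
`z`-monomial `(Δ+n, j)`)` is positive semidefinite. Discharged by the kd-tree route (`evenHeads_of_kdCheck`) or by the
FAST Taylor-model routes (`TaylorTableEvenHeadFast` / `…Parts` / the δ-expanded head files).
[cite: KosPolandSimmonsduffin2014, §3.3 eq. (3.16)] -/
def EvenHeads : Prop :=
  ∀ C ∈ T.evenCells, ∀ p ∈ T.box, ∀ Δ : ℝ, (C.lo : ℝ) ≤ Δ → Δ ≤ C.hi → ∀ a b : ℝ,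
    0 ≤ ∑ q ∈ C.F.toFinset, hrCoeff Δ C.ℓ q.1 q.2 / legendreLam C.ℓ *
      (taylorCrossing (1 / 2) (1 / 2) T.L.toFinset (fun i ab => (T.c i ab : ℝ))).evenForm p.1 p.2
        (zMono (Δ + (q.1 : ℝ)) q.2) a b

/-- **HEAD LAYER, odd sector** (route-agnostic): for every listed odd head cell, every `(Δσ, Δε)` of the box and
every `Δ` of the cell strictly above the unitarity bound, the sum over the head list of the odd cone head values is
`≥ 0`. Discharged by the kd-tree route (`oddHeads_of_kdCheck`) or by Taylor-model routes (later files).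
[cite: KosPolandSimmonsduffin2014, §3.3 eq. (3.16)] -/
def OddHeads : Prop :=
  ∀ C ∈ T.oddCells, ∀ p ∈ T.box, ∀ Δ : ℝ, (C.lo : ℝ) ≤ Δ → Δ ≤ C.hi → unitarityBound3D C.ℓ < Δ →
    0 ≤ ∑ q ∈ C.F.toFinset, oddConeHeadValue
      (taylorCrossing (1 / 2) (1 / 2) T.L.toFinset (fun k ab => (T.c k ab : ℝ)))
      (∑ ab ∈ T.Lψ.toFinset, (T.ψ ab : ℝ) • taylorCoeffAt (1 / 2) (1 / 2) ab) T.κ₀ p.1 p.2 Δ C.ℓ q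

/-! ### The capstone with head hypotheses -/

/-- **THE TABLE THEOREM (g2), head layers as hypotheses, NO enclosure hypothesis.** If the structural checks of a
rational kind-`deriv` table pass, both head layers hold (any route), the even region FIELD holds and the odd cone
holds, then the box is excluded. [cite: KosPolandSimmonsduffin2014, §3.3 eq. (3.16)] -/
theorem boxExcluded_of_taylorTable_heads (h : T.checkS = true) (hEH : T.EvenHeads) (hOH : T.OddHeads)
    (hR : TaylorEvenRegion T.α T.box ((T.E₀ : ℚ) : ℝ)) (hC : T.OddCone) : BoxExcluded T.box := by
  -- unpack the Boolean
  simp only [checkS, Bool.and_eq_true] at h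
  obtain ⟨⟨⟨⟨⟨hB, hI⟩, hEcells⟩, hEcov⟩, hOcells⟩, hOcov⟩ := h
  simp only [checkBasic, Bool.and_eq_true, decide_eq_true_eq] at hB
  obtain ⟨⟨⟨⟨⟨⟨⟨⟨hL, hLψ⟩, hκ₀⟩, hσlo⟩, hσhi⟩, hgap⟩, hE₀⟩, hLE⟩, hLT⟩ := hB
  simp only [checkIdentity, Bool.and_eq_true, decide_eq_true_eq] at hI
  obtain ⟨⟨⟨⟨hκ, hμσ⟩, hμε⟩, hbI⟩, htI⟩ := hI
  obtain ⟨hκhi, hκr₁, hκr₂, hκ₁, hκ₂⟩ := PowEncl.check_spec hκ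
  rw [List.all_eq_true] at hEcells hOcells
  have hQ : ∀ p ∈ T.box, 1 / 2 < p.1 ∧ p.1 < 1 ∧ p.1 + 1 / 2 < p.2 := by
    intro p hp
    obtain ⟨⟨h1, h2⟩, ⟨h3, _⟩⟩ := hp
    have e1 : ((1 / 2 : ℚ) : ℝ) < (T.σlo : ℝ) := by exact_mod_cast hσlo
    have e2 : (T.σhi : ℝ) < ((1 : ℚ) : ℝ) := by exact_mod_cast hσhi
    have e3 : ((T.σhi + 1 / 2 : ℚ) : ℝ) < (T.εlo : ℝ) := by exact_mod_cast hgap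
    push_cast at e1 e2 e3
    exact ⟨by linarith, by linarith, by linarith⟩
  have hE₀' : (1 / 2 : ℝ) < ((T.E₀ : ℚ) : ℝ) := by
    have h : ((1 / 2 : ℚ) : ℝ) < ((T.E₀ : ℚ) : ℝ) := by exact_mod_cast hE₀
    push_cast at h
    exact h
  refine boxExcluded_of_taylorConeObligations_half T.L.toFinset (fun k ab => (T.c k ab : ℝ)) T.Lψ.toFinset
    (fun ab => (T.ψ ab : ℝ)) (κ₀ := (T.κ₀ : ℝ)) (by exact_mod_cast hκ₀) (E₀ := ((T.E₀ : ℚ) : ℝ))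
    (E_T := ((T.E_T : ℚ) : ℝ)) hE₀' hQ ?_
  refine TaylorConeObligations.of_oddCover ?hI ?hEc ?hEr
    (T.oddCells.map fun C => ⟨C.ℓ, C.lo, C.hi, C.F.toFinset⟩) ?hOcov ?hOhead ?hOF hC
  -- (I) identity
  · exact identity_pos_of_kdCheck T.c hL hκhi hκr₁ hκr₂ hκ₁ hκ₂ htI hbI
  -- (E) even cells from the cover
  · refine evenCellField_of_cover _ T.box _ (T.evenCells.map fun C => ⟨C.ℓ, C.lo, C.hi, C.F.toFinset⟩)
      ?_ ?_ ?_ hR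
    · -- cover
      rw [checkEvenCover, Bool.and_eq_true, Bool.and_eq_true, List.any_eq_true, List.all_eq_true] at hEcov
      obtain ⟨⟨⟨Cε, hCε, hCε'⟩, h3⟩, hℓ⟩ := hEcov
      rw [Bool.and_eq_true, Bool.and_eq_true, decide_eq_true_iff, decide_eq_true_iff, decide_eq_true_iff] at hCε'
      obtain ⟨⟨hCε0, hCεlo⟩, hCεhi⟩ := hCε'
      refine evenCover_of_perSpin T.box _ _ T.LE (by exact_mod_cast hLE) ?_ ?_ ?_
      · intro p hp
        refine ⟨⟨Cε.ℓ, Cε.lo, Cε.hi, Cε.F.toFinset⟩, List.mem_map.mpr ⟨Cε, hCε, rfl⟩, hCε0, ?_, ?_⟩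
        · exact le_trans (by exact_mod_cast hCεlo : ((Cε.lo : ℚ) : ℝ) ≤ (T.εlo : ℝ)) hp.2.1
        · exact le_trans hp.2.2 (by exact_mod_cast hCεhi : (T.εhi : ℝ) ≤ ((Cε.hi : ℚ) : ℝ))
      · intro Δ h3Δ hΔE
        obtain ⟨I, hI, h1, h2⟩ := chainCovers_sound _ _ _ h3 Δ (by exact_mod_cast h3Δ) hΔE.le
        obtain ⟨C, hC, hCℓ, rfl⟩ := T.exists_evenCell_of_mem_ivls hI
        exact ⟨⟨C.ℓ, C.lo, C.hi, C.F.toFinset⟩, List.mem_map.mpr ⟨C, hC, rfl⟩, hCℓ, h1, h2⟩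
      · intro ℓ hev h1ℓ hℓL Δ hbΔ hΔE
        have hch : chainCovers ((ℓ : ℚ) + 1) T.E₀ (T.evenIvls ℓ) = true := by
          have h := hℓ ℓ (List.mem_range.mpr hℓL)
          rw [Bool.or_eq_true, Bool.or_eq_true, decide_eq_true_iff, Bool.not_eq_true', decide_eq_false_iff_not] at h
          rcases h with (h | h) | h
          · omega
          · exact absurd hev h
          · exact h
        obtain ⟨I, hI, h1, h2⟩ := chainCovers_sound _ _ _ hch Δ (by push_cast; exact hbΔ) hΔE.le
        obtain ⟨C, hC, hCℓ, rfl⟩ := T.exists_evenCell_of_mem_ivls hI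
        exact ⟨⟨C.ℓ, C.lo, C.hi, C.F.toFinset⟩, List.mem_map.mpr ⟨C, hC, rfl⟩, hCℓ, h1, h2⟩
    · -- heads: the hypothesis
      intro c hc p hp Δ ha hb _ _ _ a b
      obtain ⟨C, hC, rfl⟩ := List.mem_map.mp hc
      exact hEH C hC p hp Δ ha hb a b
    · -- off the head set
      intro c hc q hq hr
      obtain ⟨C, hC, rfl⟩ := List.mem_map.mp hc
      have hcell := hEcells C hC
      simp only [checkEvenCellS, Bool.and_eq_true, decide_eq_true_eq, List.all_eq_true] at hcell
      obtain ⟨⟨⟨_, _⟩, _⟩, hcanon⟩ := hcell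
      exact offHead_of_canonOK hcanon q hq hr
  -- (E5) even region
  · exact hR
  -- odd cover
  · rw [checkOddCover, Bool.and_eq_true, Bool.and_eq_true, List.any_eq_true, List.all_eq_true] at hOcov
    obtain ⟨⟨⟨Cσ, hCσ, hCσ'⟩, h3⟩, hℓ⟩ := hOcov
    rw [Bool.and_eq_true, Bool.and_eq_true, decide_eq_true_iff, decide_eq_true_iff, decide_eq_true_iff] at hCσ'
    obtain ⟨⟨hCσ0, hCσlo⟩, hCσhi⟩ := hCσ'
    refine oddCover_of_perSpin T.box _ _ T.LT (by exact_mod_cast hLT) ?_ ?_ ?_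
    · intro p hp
      refine ⟨⟨Cσ.ℓ, Cσ.lo, Cσ.hi, Cσ.F.toFinset⟩, List.mem_map.mpr ⟨Cσ, hCσ, rfl⟩, hCσ0, ?_, ?_⟩
      · exact le_trans (by exact_mod_cast hCσlo : ((Cσ.lo : ℚ) : ℝ) ≤ (T.σlo : ℝ)) hp.1.1
      · exact le_trans hp.1.2 (by exact_mod_cast hCσhi : (T.σhi : ℝ) ≤ ((Cσ.hi : ℚ) : ℝ))
    · intro Δ h3Δ hΔE
      obtain ⟨I, hI, h1, h2⟩ := chainCovers_sound _ _ _ h3 Δ (by exact_mod_cast h3Δ) hΔE.le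
      obtain ⟨C, hC, hCℓ, rfl⟩ := T.exists_oddCell_of_mem_ivls hI
      exact ⟨⟨C.ℓ, C.lo, C.hi, C.F.toFinset⟩, List.mem_map.mpr ⟨C, hC, rfl⟩, hCℓ, h1, h2⟩
    · intro ℓ h1ℓ hℓL Δ hbΔ hΔE
      have hch : chainCovers ((ℓ : ℚ) + 1) T.E_T (T.oddIvls ℓ) = true := by
        have h := hℓ ℓ (List.mem_range.mpr hℓL)
        rw [Bool.or_eq_true, decide_eq_true_iff] at h
        rcases h with h | h
        · omega
        · exact h
      obtain ⟨I, hI, h1, h2⟩ := chainCovers_sound _ _ _ hch Δ (by push_cast; exact hbΔ.le) hΔE.le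
      obtain ⟨C, hC, hCℓ, rfl⟩ := T.exists_oddCell_of_mem_ivls hI
      exact ⟨⟨C.ℓ, C.lo, C.hi, C.F.toFinset⟩, List.mem_map.mpr ⟨C, hC, rfl⟩, hCℓ, h1, h2⟩
  -- odd heads: the hypothesis (regularised: uses `b_ℓ < Δ`)
  · intro c hc p hp Δ ha hb hbΔ _ _
    obtain ⟨C, hC, rfl⟩ := List.mem_map.mp hc
    exact hOH C hC p hp Δ ha hb hbΔ
  -- off the odd head sets
  · intro c hc q hq hr
    obtain ⟨C, hC, rfl⟩ := List.mem_map.mp hc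
    have hcell := hOcells C hC
    simp only [checkOddCellS, Bool.and_eq_true, decide_eq_true_eq, List.all_eq_true] at hcell
    obtain ⟨⟨⟨_, _⟩, _⟩, hcanon⟩ := hcell
    exact offHead_of_canonOK hcanon q hq hr

/-! ### The kd-tree route as one instance of the head hypotheses -/

/-- **Even heads, kd-tree route**: every even cell passes `checkEvenCell` and the decidable even enclosure check ⇒
`EvenHeads`. [cite: KosPolandSimmonsduffin2014, §3.3 eq. (3.16)] -/
theorem evenHeads_of_kdCheck (hL : T.L.Nodup) (hcells : T.evenCells.all T.checkEvenCell = true)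
    (henc : T.evenCells.all evenEnclOK = true) : T.EvenHeads := by
  rw [List.all_eq_true] at hcells
  have hEnc := T.evenEnclosures_of_check henc
  intro C hC p hp Δ ha hb a b
  have hcell := hcells C hC
  simp only [checkEvenCell, Bool.and_eq_true, decide_eq_true_eq, List.all_eq_true] at hcell
  obtain ⟨⟨⟨⟨⟨⟨⟨hFnd, hFj⟩, hℓlo⟩, hAlen⟩, _⟩, hX⟩, hY⟩, hD⟩ := hcell
  exact evenHead_nonneg_of_kdCheck T.c hL C.ℓ hFnd (fun q hq => hFj q hq) hℓlo hAlen
    (hEnc C hC) hX hY hD p hp Δ ha hb a b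

/-- The odd conjunct of `EnclosuresStrict` from the per-cell decidable odd enclosure checks alone (the proof of
`enclosuresStrict_of_checkEncl`, odd half). [cite: DolanOsborn2004, §3 eq. (3.12)] -/
theorem oddEnclosuresStrict_of_check (ho : T.oddCells.all T.oddEnclOK = true) :
    ∀ C ∈ T.oddCells, ∀ p ∈ T.box, ∀ Δ : ℝ, (C.lo : ℝ) ≤ Δ → Δ ≤ C.hi → unitarityBound3D C.ℓ < Δ →
      ∀ (i : ℕ) (q : ℕ × ℕ) (I : (ℚ × ℚ) × (ℚ × ℚ) × (ℚ × ℚ)), C.F[i]? = some q → C.A[i]? = some I →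
        ((I.1.1 : ℝ) ≤ (oddCoeffsReg p.1 p.2 Δ C.ℓ q).1 ∧ (oddCoeffsReg p.1 p.2 Δ C.ℓ q).1 ≤ (I.1.2 : ℝ)) ∧
        ((I.2.1.1 : ℝ) ≤ (oddCoeffsReg p.1 p.2 Δ C.ℓ q).2.1 ∧ (oddCoeffsReg p.1 p.2 Δ C.ℓ q).2.1 ≤ (I.2.1.2 : ℝ)) ∧
        ((I.2.2.1 : ℝ) ≤ (oddCoeffsReg p.1 p.2 Δ C.ℓ q).2.2 ∧ (oddCoeffsReg p.1 p.2 Δ C.ℓ q).2.2 ≤ (I.2.2.2 : ℝ)) := by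
  rw [List.all_eq_true] at ho
  intro C hC p hp Δ hlo hhi hbΔ i q I hq hI
  have hc := ho C hC
  simp only [oddEnclOK, Bool.and_eq_true, decide_eq_true_eq, List.all_eq_true] at hc
  obtain ⟨_, hall⟩ := hc
  have hmem : (q, I) ∈ List.zip C.F C.A :=
    List.mem_iff_getElem?.mpr ⟨i, by rw [List.getElem?_zip_eq_some]; exact ⟨hq, hI⟩⟩
  obtain ⟨⟨hS, hP⟩, hM⟩ := hall _ hmem
  obtain ⟨⟨hσ1, hσ2⟩, ⟨hε1, hε2⟩⟩ := hp
  have ht1 : ((T.σlo - T.εhi : ℚ) : ℝ) ≤ p.1 - p.2 := by push_cast; linarith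
  have ht2 : p.1 - p.2 ≤ ((T.σhi - T.εlo : ℚ) : ℝ) := by push_cast; linarith
  have haS : (((-(T.σhi - T.εlo) / 2 : ℚ)) : ℝ) ≤ -(p.1 - p.2) / 2 ∧
      -(p.1 - p.2) / 2 ≤ ((-(T.σlo - T.εhi) / 2 : ℚ) : ℝ) := by
    constructor <;> push_cast at ht1 ht2 ⊢ <;> linarith
  have hbS : (((T.σlo - T.εhi) / 2 : ℚ) : ℝ) ≤ (p.1 - p.2) / 2 ∧
      (p.1 - p.2) / 2 ≤ (((T.σhi - T.εlo) / 2 : ℚ) : ℝ) := by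
    constructor <;> push_cast at ht1 ht2 ⊢ <;> linarith
  refine ⟨?_, ?_, ?_⟩
  · simpa [oddCoeffsReg, oddCoeffs] using oddEnclFamilyOK_sound hS haS hbS ⟨hlo, hhi⟩ hbΔ
  · simpa [oddCoeffsReg, oddCoeffs] using oddEnclFamilyOK_sound hP hbS hbS ⟨hlo, hhi⟩ hbΔ
  · simpa [oddCoeffsReg, oddCoeffs] using oddEnclFamilyOK_sound hM haS haS ⟨hlo, hhi⟩ hbΔ

/-- **Odd heads, kd-tree route**: basic checks (for `L`, `Lψ` duplicate-free), the power enclosures of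
`checkIdentity`, every odd cell passes `checkOddCell`, and the decidable odd enclosure check ⇒ `OddHeads`.
[cite: KosPolandSimmonsduffin2014, §3.3 eq. (3.16)] -/
theorem oddHeads_of_kdCheck (hB : T.checkBasic = true) (hI : T.checkIdentity = true)
    (hcells : T.oddCells.all T.checkOddCell = true) (henc : T.oddCells.all T.oddEnclOK = true) : T.OddHeads := by
  simp only [checkBasic, Bool.and_eq_true, decide_eq_true_eq] at hB
  obtain ⟨⟨⟨⟨⟨⟨⟨⟨hL, hLψ⟩, _⟩, _⟩, _⟩, _⟩, _⟩, _⟩, _⟩ := hB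
  simp only [checkIdentity, Bool.and_eq_true, decide_eq_true_eq] at hI
  obtain ⟨⟨⟨⟨hκ, hμσ⟩, hμε⟩, _⟩, _⟩ := hI
  obtain ⟨hκhi, hκr₁, hκr₂, hκ₁, hκ₂⟩ := PowEncl.check_spec hκ
  obtain ⟨hμσhi, hμσr₁, hμσr₂, hμσ₁, hμσ₂⟩ := PowEncl.check_spec hμσ
  obtain ⟨hμεhi, hμεr₁, hμεr₂, hμε₁, hμε₂⟩ := PowEncl.check_spec hμε
  rw [List.all_eq_true] at hcells
  have hEnc := T.oddEnclosuresStrict_of_check henc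
  intro C hC p hp Δ ha hb hbΔ
  have hcell := hcells C hC
  simp only [checkOddCell, Bool.and_eq_true, decide_eq_true_eq, List.all_eq_true] at hcell
  obtain ⟨⟨⟨⟨⟨hFnd, hFj⟩, hℓlo⟩, hAlen⟩, _⟩, ht⟩ := hcell
  exact oddHead_nonneg_of_kdCheck_reg' T.c hL T.ψ hLψ T.κ₀ C.ℓ hFnd (fun q hq => hFj q hq) hℓlo
    hκhi hκr₁ hκr₂ hκ₁ hκ₂ hμσhi hμσr₁ hμσr₂ hμσ₁ hμσ₂ hμεhi hμεr₁ hμεr₂ hμε₁ hμε₂ hAlen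
    (hEnc C hC) ht p hp Δ ha hb hbΔ

/-- **Consistency**: the hypotheses of the landed all-decidable table theorem `boxExcluded_of_taylorTable_dec`
(`T.check`, `T.checkEncl`) give both head layers — so that theorem factors through
`boxExcluded_of_taylorTable_heads` (checked in the seat: the composite has literally the landed statement).
[cite: KosPolandSimmonsduffin2014, §3.3 eq. (3.16)] -/
theorem heads_of_check_checkEncl (h : T.check = true) (he : T.checkEncl = true) : T.EvenHeads ∧ T.OddHeads := by
  simp only [check, Bool.and_eq_true] at h
  obtain ⟨⟨⟨⟨⟨hB, hI⟩, hEcells⟩, _⟩, hOcells⟩, _⟩ := h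
  have hL : T.L.Nodup := by
    have hB' := hB
    simp only [checkBasic, Bool.and_eq_true, decide_eq_true_eq] at hB'
    exact hB'.1.1.1.1.1.1.1.1
  rw [checkEncl, Bool.and_eq_true] at he
  exact ⟨T.evenHeads_of_kdCheck hL hEcells he.1, T.oddHeads_of_kdCheck hB hI hOcells he.2⟩

/-- **MIXED route placeholder made precise**: structural checks + ANY proof of `EvenHeads` (e.g. the FAST Taylor-model
layer) + the kd-tree odd route + the two region layers ⇒ box excluded. [cite: KosPolandSimmonsduffin2014, §3.3 eq. (3.16)] -/
theorem boxExcluded_of_taylorTable_evenHeads_oddKd (h : T.checkS = true) (hEH : T.EvenHeads)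
    (hcells : T.oddCells.all T.checkOddCell = true) (henc : T.oddCells.all T.oddEnclOK = true)
    (hR : TaylorEvenRegion T.α T.box ((T.E₀ : ℚ) : ℝ)) (hC : T.OddCone) : BoxExcluded T.box := by
  have h' := h
  simp only [checkS, Bool.and_eq_true] at h'
  obtain ⟨⟨⟨⟨⟨hB, hI⟩, _⟩, _⟩, _⟩, _⟩ := h'
  exact T.boxExcluded_of_taylorTable_heads h hEH (T.oddHeads_of_kdCheck hB hI hcells henc) hR hC

end TaylorTable

end Summit.CriticalPhenomena.Ising3D
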